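import Summits.Schanuel.Schanuel.Theorems.SoloInformedAE2GelfondInput
import Summits.Schanuel.Schanuel.Theorems.SoloInformedAE3GenericStructuredRoots
import Summits.Schanuel.Schanuel.Theorems.SoloInformedAE3GenericGelfondInput

/-!
# Theorem AE₃-2 (η = 0), middle: prime dilates WITH derivatives → a Gel'fond input (3-AP form)

Soloist file (informed mode, seat `solo-Schanuel-informed`, s182).  The per-`n` step of the
seat's THEOREM AE₃-2 (`paper/AE-note.md` §14; `work/s182/AE3-note.md` §4) on the node
`RoyAdditiveDirichletExponent` ([cite: Roy2010, Thm 1.1]), CONDITIONAL on two displayed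
hypotheses of D. Roy: the pointwise transfer estimate [cite: Roy2010, Cor 3.2] (`hR1`) and,
for the current `n`, the conclusion of the dilation-gcd estimate [cite: Roy2010, Thm 1.2]
(`hR2n`, discharged from `thm_1_2` for `n ≥ n₀` in the assembly file).

`soloA32_gelfond_input` is `soloAG_gelfond_input` (file `SoloInformedAE2GelfondInput`, whose
three small helper lemmas on `primesLe` are reused) with the squared-difference rigidity step
replaced by the 3-term-AP one: after the SAME transfer / few-bad-points / stripping / dilation-gcd
steps (now with the bad-set budget constant `80000`, so that `80000·#E ≤ K`), the structured
roots of `radical Q̃` at the root-count scale `N` come from `soloG3S_structured_roots` (budget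
`400000 (3 D₀² L₀ + 2 D₀³) ≤ K² W`, `W = V K/(160000 N)`, in place of
`11000 (2 D₀³ L₀ + 2 D₀⁴) ≤ K³ W`, `W = V K/(400 N)`; hypotheses `h₂`, `h₃` of the AE-2 form
are no longer needed and `h₄` becomes `log 4 ≤ V K/(320000 N)`), and the Gel'fond input from
`soloG3G_gelfond_input`: a non-zero `Q' ∈ ℤ[X]` with `deg Q' ≤ 20 (N/t)/K`,
type `≤ (20 (N/t)/K)(2 + log K) + 20 ((N/2 + Lg)/t)/K` and `|Q'(ξ)| ≤ exp(-W/2)`.  The explicit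
inequalities `hA, hbud, h₁, h₄, h₅, h₆` are all eventually true when `ν > β + 2(1 - σ - τ)` and
`2σ + τ > 1` (`x = n^μ`, `K = ⌊n^{σ-μ}⌋`, `N = ⌊n^{1-μ+δ}⌋`, `Lg = n^{β-μ+δ}`, `μ` just above
`1 - σ - τ`); that bookkeeping and Gel'fond's criterion are the next two files.

What this is NOT.  Conditional on [cite: Roy2010, Cor 3.2] and (per `n`) [cite: Roy2010,
Thm 1.2] as displayed; not yet THEOREM AE₃-2, and nothing here bears on
`Literature.Periods.SchanuelConjecture` (the seat's verdict, no path, is unchanged); the node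
[cite: Roy2010, Thm 1.1] is not claimed.  Tree files and Mathlib only; no definitions;
axioms the standard three.
-/

namespace Summit.Schanuel.Schanuel.Theorems

open Polynomial Finset UniqueFactorizationMonoid
open Literature.NumberTheory.Transcendental.Roy2010 (cor_3_2 primesLe dilationGcd)

/-- **AE₃-2 per `n` (conditional on [Roy2010, Cor 3.2] and, for this `n`, [Roy2010,
Thm 1.2]); 3-term-AP form of `soloAG_gelfond_input`.**  See the module docstring. -/
theorem soloA32_gelfond_input (hR1 : cor_3_2) {ξ : ℂ} (hξ : Transcendental ℚ ξ)
    {β σ τ ν : ℝ} {n K t N : ℕ} (hn : 1 ≤ n) (hK : 2000 ≤ K) (hN : 1 ≤ N)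
    {x : ℝ} (hx : 3 ≤ x) (hKx : (K : ℝ) * x ≤ (n : ℝ) ^ σ) (ht : 1 ≤ t)
    (htτ : 2 * ((t : ℝ) - 1) ≤ (n : ℝ) ^ τ) (hKt : K * t ≤ n) {Lg : ℝ} (hLg : 0 ≤ Lg)
    (hR2n : ∀ G : ℤ[X], G ≠ 0 → G.natDegree ≤ n → G.supNorm ≤ Real.exp ((n : ℝ) ^ β) →
      G.coeff 0 ≠ 0 → ((dilationGcd (primesLe x) G).natDegree : ℝ) ≤ N ∧
        (dilationGcd (primesLe x) G).supNorm ≤ Real.exp Lg)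
    {c₁ : ℝ} (hc : Real.exp (-c₁) ≤ min 1 (‖ξ‖ / 2))
    (hA : (n : ℝ) ^ ν / 8 ≤ ((n : ℝ) ^ ν - (n : ℝ) ^ τ * Real.log (2 * x)) -
      (n : ℝ) ^ ν / 2 - 4 * n * Real.log (2 + K * ‖ξ‖) + n * Real.log (min 1 ‖ξ‖))
    (hbud : 80000 * (10 * (n : ℝ) ^ 2 + 2 * n * (n * Real.log (2 * x) + (n : ℝ) ^ β)) ≤
      K * (t * ((n : ℝ) ^ ν / 8)))
    {V : ℝ} (hV : V ≤ (n : ℝ) ^ ν / 2 + n * Real.log (min 1 ‖ξ‖))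
    (h₁ : 2 * c₁ * N ≤ V)
    (h₄ : Real.log 4 ≤ V * K / (320000 * N))
    (h₅ : 400000 * (3 * ((N : ℝ) / t) ^ 2 * (((N : ℝ) / 2 + Lg) / t) + 2 * ((N : ℝ) / t) ^ 3) ≤
      (K : ℝ) ^ 2 * (V * K / (160000 * N)))
    (h₆ : 20 * ((N : ℝ) / t) / K * Real.log (K * ‖ξ‖ + 1) + 20 * (((N : ℝ) / 2 + Lg) / t) / K ≤
      V * K / (160000 * N) / 2)
    {P : ℤ[X]} (hP : P ∈ RoyAdditiveSmall ξ β σ τ ν n) :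
    ∃ Q : ℤ[X], Q ≠ 0 ∧ (Q.natDegree : ℝ) ≤ 20 * ((N : ℝ) / t) / K ∧
      Q.gelfondType ≤ 20 * ((N : ℝ) / t) / K * (2 + Real.log K) +
        20 * (((N : ℝ) / 2 + Lg) / t) / K ∧
      ‖aeval ξ Q‖ ≤ Real.exp (-(V * K / (160000 * N) / 2)) := by
  classical
  have hdegτ := soloAT_rpow_lt_natDegree hn hP
  have hP' := hP
  obtain ⟨hP0, hdeg, hht, -⟩ := hP'
  have hn0 : (0 : ℝ) < n := by exact_mod_cast hn
  have hN0 : (0 : ℝ) < N := by exact_mod_cast hN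
  have ht0 : 0 < t := by omega
  have ht0' : (0 : ℝ) < t := by exact_mod_cast ht0
  have hx0 : (0 : ℝ) ≤ x := by linarith
  have hξ0 : ξ ≠ 0 := by
    intro h
    apply hξ
    rw [h]
    exact isAlgebraic_zero
  -- the set of primes and the index set of the family
  set A : Finset ℕ := primesLe x with hAdef
  have hAmem : ∀ a ∈ A, a.Prime ∧ (1 : ℝ) ≤ a ∧ (a : ℝ) ≤ x := by
    intro a ha
    obtain ⟨hp, hax⟩ := soloAG_mem_primesLe ha
    refine ⟨hp, by exact_mod_cast hp.one_lt.le, ?_⟩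
    exact le_trans (by exact_mod_cast hax) (Nat.floor_le hx0)
  have hAne : ∀ a ∈ A, a ≠ 0 := fun a ha => (hAmem a ha).1.ne_zero
  have h2A : 2 ∈ A := soloAG_mem_primesLe_of Nat.prime_two (by norm_num; linarith)
  set s : Finset (ℕ × ℕ) := A ×ˢ Finset.range t with hsdef
  have hr : 2 ≤ s.card := by
    rw [hsdef, Finset.card_product, Finset.card_range]
    exact le_trans (soloAG_two_le_card_primesLe hx) (Nat.le_mul_of_pos_right _ ht0)
  have hys : ∀ y : {y // y ∈ s}, y.1.1 ∈ A ∧ y.1.2 < t := fun y => by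
    have h := Finset.mem_product.mp y.2
    exact ⟨h.1, Finset.mem_range.mp h.2⟩
  obtain ⟨Pf, hPf⟩ : ∃ Pf : Fin s.card → ℤ[X], ∀ i, Pf i =
      hasseDeriv (s.equivFin.symm i).1.2
        (P.comp (C (((s.equivFin.symm i).1.1 : ℕ) : ℤ) * X)) := ⟨_, fun _ => rfl⟩
  -- orders of derivatives stay below `n^τ` and below `deg P`
  have hat : ∀ a j : ℕ, a < t → j < t → ((j + a : ℕ) : ℝ) ≤ (n : ℝ) ^ τ := by
    intro a j ha hj
    have h : j + a ≤ 2 * (t - 1) := by omega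
    have h' : ((j + a : ℕ) : ℝ) ≤ ((2 * (t - 1) : ℕ) : ℝ) := by exact_mod_cast h
    have h'' : ((2 * (t - 1) : ℕ) : ℝ) = 2 * ((t : ℝ) - 1) := by
      rw [Nat.cast_mul, Nat.cast_sub (by omega)]
      push_cast
      ring
    linarith
  have haP : ∀ a : ℕ, a < t → a ≤ P.natDegree := by
    intro a ha
    have h1 := hat a 0 ha ht0
    rw [zero_add] at h1
    have h2 : (a : ℝ) < P.natDegree := lt_of_le_of_lt h1 hdegτ
    exact_mod_cast h2.le
  -- the family: non-zero, degree ≤ n, height ≤ H, small derivatives at `cξ`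
  have hPf0 : ∀ i, Pf i ≠ 0 := by
    intro i
    rw [hPf]
    obtain ⟨ha, hj⟩ := hys (s.equivFin.symm i)
    exact soloDL_hasseDeriv_comp_ne_zero hP0 (Nat.cast_ne_zero.mpr (hAne _ ha)) (haP _ hj)
  have hPfdeg : ∀ i, (Pf i).natDegree ≤ n := by
    intro i
    rw [hPf]
    exact (soloDL_natDegree_hasseDeriv_comp_le P _ _).trans hdeg
  set H : ℝ := (2 * x) ^ n * Real.exp ((n : ℝ) ^ β) with hH
  have h2x : (1 : ℝ) ≤ 2 * x := by linarith
  have hH1 : 1 ≤ H := by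
    have h1 : (1 : ℝ) ≤ (2 * x) ^ n := one_le_pow₀ h2x
    have h2 : (1 : ℝ) ≤ Real.exp ((n : ℝ) ^ β) := Real.one_le_exp (by positivity)
    nlinarith
  have hlogH : Real.log H = n * Real.log (2 * x) + (n : ℝ) ^ β := by
    rw [hH, Real.log_mul (by positivity) (Real.exp_pos _).ne', Real.log_exp, Real.log_pow]
  have hpolyH : (0 : ℝ) ≤ (polyHeight P : ℝ) := P.supNorm_nonneg.trans (supNorm_le_polyHeight P)
  have hPfH : ∀ i, (Pf i).supNorm ≤ H := by
    intro i
    rw [hPf]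
    obtain ⟨ha, -⟩ := hys (s.equivFin.symm i)
    obtain ⟨-, ha1, hax⟩ := hAmem _ ha
    have ha1' : 1 ≤ (s.equivFin.symm i).1.1 := by exact_mod_cast ha1
    refine (soloDL_supNorm_hasseDeriv_comp_le_polyHeight hdeg ha1' _).trans ?_
    exact mul_le_mul (pow_le_pow_left₀ (by positivity) (by linarith) n) hht hpolyH
      (by positivity)
  have hval : ∀ c ∈ Icc 1 K, ∀ i : Fin s.card, ∀ j : ℕ, j < t →
      ‖aeval ((c : ℂ) * ξ) (hasseDeriv j (Pf i))‖ ≤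
        Real.exp (-((n : ℝ) ^ ν - (n : ℝ) ^ τ * Real.log (2 * x))) := by
    intro c hc i j hj
    rw [hPf]
    obtain ⟨ha, hj₀⟩ := hys (s.equivFin.symm i)
    obtain ⟨-, ha1, hax⟩ := hAmem _ ha
    have ha1' : 1 ≤ (s.equivFin.symm i).1.1 := by exact_mod_cast ha1
    have hcK : (c : ℝ) ≤ K := by exact_mod_cast (Finset.mem_Icc.mp hc).2
    have hac : (((s.equivFin.symm i).1.1 * c : ℕ) : ℝ) ≤ (n : ℝ) ^ σ := by
      push_cast
      calc ((s.equivFin.symm i).1.1 : ℝ) * c ≤ x * K :=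
            mul_le_mul hax hcK (Nat.cast_nonneg _) hx0
        _ = K * x := mul_comm _ _
        _ ≤ (n : ℝ) ^ σ := hKx
    have hjh := hat j _ hj hj₀
    have hB : (2 * ((s.equivFin.symm i).1.1 : ℝ)) ^ ((s.equivFin.symm i).1.2 + j) ≤
        Real.exp ((n : ℝ) ^ τ * Real.log (2 * x)) := by
      refine (soloDL_pow_le_exp ha1' hjh).trans (Real.exp_le_exp.mpr ?_)
      exact mul_le_mul_of_nonneg_left
        (Real.log_le_log (by linarith) (by linarith)) (by positivity)
    exact soloDL_norm_aeval_le_exp hP hac hjh hB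
  -- Step T′: few bad points for the primitive gcd `Q` (budget constant `80000`)
  have hbud' : 80000 * (10 * (n : ℝ) ^ 2 + 2 * n * Real.log H) ≤
      K * (t * ((n : ℝ) ^ ν / 8)) := by rwa [hlogH]
  have hEb := soloPT_few_bad_points (X := (n : ℝ) ^ ν / 2) hR1 hξ0 (by omega) ht0 hKt hr
    hPf0 hPfdeg hH1 hPfH hval hA
  have hoff := soloPT_small_off_bad ξ K Pf ((n : ℝ) ^ ν / 2)
  set Q := ((univ : Finset (Fin s.card)).gcd Pf).primPart with hQ
  set E := (Icc 1 K).filter fun c : ℕ => Real.exp (-((n : ℝ) ^ ν / 2)) <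
    ‖aeval ((c : ℂ) * ξ) Q‖ with hEdef
  have hE : 80000 * #E ≤ K := by
    have htA : (0 : ℝ) < t * ((n : ℝ) ^ ν / 8) := by positivity
    have h1 : ((80000 * #E : ℕ) : ℝ) * (t * ((n : ℝ) ^ ν / 8)) ≤
        (K : ℝ) * (t * ((n : ℝ) ^ ν / 8)) := by
      push_cast
      calc (80000 : ℝ) * #E * (t * ((n : ℝ) ^ ν / 8))
          = 80000 * ((#E : ℝ) * (t * ((n : ℝ) ^ ν / 8))) := by ring
        _ ≤ 80000 * (10 * (n : ℝ) ^ 2 + 2 * n * Real.log H) :=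
            mul_le_mul_of_nonneg_left hEb (by norm_num)
        _ ≤ (K : ℝ) * (t * ((n : ℝ) ^ ν / 8)) := hbud'
    exact_mod_cast le_of_mul_le_mul_right h1 htA
  have hQ0 : Q ≠ 0 := primPart_ne_zero _
  have hQprim : Q.IsPrimitive := isPrimitive_primPart _
  have hdvd : ∀ a ∈ A, ∀ j < t, Q ∣ hasseDeriv j (P.comp (C (a : ℤ) * X)) := by
    intro a ha j hj
    have hy : (a, j) ∈ s := Finset.mem_product.mpr ⟨ha, Finset.mem_range.mpr hj⟩
    have h1 : (univ : Finset (Fin s.card)).gcd Pf ∣ Pf (s.equivFin ⟨(a, j), hy⟩) :=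
      Finset.gcd_dvd (Finset.mem_univ _)
    rw [hPf, Equiv.symm_apply_apply] at h1
    exact (primPart_dvd _).trans h1
  have hQdeg : Q.natDegree ≤ n := by
    have h1 := hdvd 2 h2A 0 ht0
    rw [hasseDeriv_zero'] at h1
    exact ((natDegree_le_of_dvd h1 (soloDL_comp_ne_zero hP0 two_ne_zero)).trans
      (soloDL_natDegree_comp_le P 2)).trans hdeg
  -- strip the powers of `X`: `P = X^k P̃`, `Q = X^e Q̃`
  obtain ⟨k, Pt, hPk, hPt0c⟩ := soloDR_exists_X_pow_mul hP0
  obtain ⟨e, Qt, hQe, hQt0, hQtprim, -, he, hQtG, hRG⟩ :=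
    soloDR_strip hP0 hPk hQ0 hQprim hAne h2A ht hdvd
  have hPt : Pt ≠ 0 := soloDR_right_ne_zero hP0 hPk
  have hPtdeg : Pt.natDegree ≤ n := by
    have h1 := soloDR_natDegree_eq hP0 hPk
    omega
  have hPtH : Pt.supNorm ≤ Real.exp ((n : ℝ) ^ β) := (soloDR_supNorm_le_polyHeight hPk).trans hht
  obtain ⟨hGdeg, hGsup⟩ := hR2n Pt hPt hPtdeg hPtH hPt0c
  obtain ⟨hb1, hD, hL⟩ := soloDR_bounds ht hQtG hRG hGdeg hGsup
  have hQtdegN : Qt.natDegree ≤ N := by exact_mod_cast hb1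
  -- the radical `R` of `Q̃`
  set R := radical Qt with hR
  have hR0 : R ≠ 0 := radical_ne_zero
  have hQR : ∀ z : ℂ, aeval z Qt = 0 → aeval z R = 0 := fun z hz =>
    soloDR_aeval_radical_eq_zero hQt0 z hz
  -- values of `Q̃` off the bad set
  set m : ℝ := min 1 ‖ξ‖ with hm
  have hm0 : 0 < m := lt_min one_pos (norm_pos_iff.mpr hξ0)
  have hm1 : m ≤ 1 := min_le_left _ _
  have hmn : m ^ n = Real.exp (n * Real.log m) := by
    rw [Real.exp_nat_mul, Real.exp_log hm0]
  have hsmall : ∀ c ∈ Icc 1 K \ E, ‖aeval ((c : ℂ) * ξ) Qt‖ ≤ Real.exp (-V) := by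
    intro c hc
    have hc1 : 1 ≤ c := (Finset.mem_Icc.mp (Finset.mem_sdiff.mp hc).1).1
    have hz : m ≤ ‖(c : ℂ) * ξ‖ := by
      rw [norm_mul, Complex.norm_natCast]
      have hc1' : (1 : ℝ) ≤ c := by exact_mod_cast hc1
      calc m ≤ ‖ξ‖ := min_le_right _ _
        _ = 1 * ‖ξ‖ := (one_mul _).symm
        _ ≤ c * ‖ξ‖ := mul_le_mul_of_nonneg_right hc1' (norm_nonneg _)
    calc ‖aeval ((c : ℂ) * ξ) Qt‖ ≤ ‖aeval ((c : ℂ) * ξ) Q‖ / m ^ n :=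
          soloDR_norm_aeval_strip_le hQe (he.trans hQdeg) hm0 hm1 hz
      _ ≤ Real.exp (-((n : ℝ) ^ ν / 2)) / m ^ n :=
          div_le_div_of_nonneg_right (hoff c hc) (pow_pos hm0 n).le
      _ = Real.exp (-((n : ℝ) ^ ν / 2 + n * Real.log m)) := by
          rw [hmn, ← Real.exp_sub]
          ring_nf
      _ ≤ Real.exp (-V) := Real.exp_le_exp.mpr (by linarith)
  have hD₀ : (0 : ℝ) < (N : ℝ) / t := by positivity
  have hL₀ : (0 : ℝ) < ((N : ℝ) / 2 + Lg) / t := by positivity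
  -- Steps 1–3: structured roots of `R` at the root-count scale `N` (3-AP form)
  obtain ⟨S', hS'sub, hS'card, γ, w, hw, hroots⟩ :=
    soloG3S_structured_roots hN hK hQt0 hQtdegN hR0 hQR hD hL E hE hc h₁ hsmall h₄ h₅
  -- Steps 4–5: the Gel'fond input
  exact soloG3G_gelfond_input hξ (by omega) hR0 hD₀ hL₀ hD hL hS'sub hS'card hw hroots h₆

end Summit.Schanuel.Schanuel.Theorems
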